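import Literature.NumberTheory.Automorphic.UnitaryGroupBorelSiegelSet
import Literature.NumberTheory.Automorphic.UnitaryGroupBorelSiegelSetStructure
import Literature.NumberTheory.Automorphic.UnitaryGroupTorusSiegelIntegral
import Literature.NumberTheory.Automorphic.UnitaryGroupHeisenbergConjThreeFactorBound
import HarnessLib

/-!
# GLUE (ρ): on the Siegel set of `U(J₃)` the archimedean root norms decay like `H^{-1/[E:ℚ]}`, and the
# torus factor of the thin set lies in «compact · ray»

(Rogawski, *Automorphic Representations of Unitary Groups in Three Variables* (1990), §2.2 p. 13; Borel,
*Introduction aux groupes arithmétiques* (1969), §12.3: on a Siegel set `𝔖 = ω A_t K` the simple roots are bounded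
below on `A_t`; Arthur (1978), §8.)

Topic `NumberTheory/Automorphic`; namespace `Literature.NumberTheory.Automorphic.UnitaryGroup`. THEOREMS ONLY
(no definition, no named fact, no instance, no notation, no `sorry`). The trunk's GLUE (ρ) of the T1-qs sub-line
(`TruncatedKernelIntegrable`) of `Cruxes/H413/Lines/F0_T1InnerFormTraceIdentity.lean` (cell `pub/hodgecm-mathlib`,
crux H413), feeding the `hρ` and `hray` premises of ★ `setLIntegral_lt_top_of_subset_thinSet` (row H10a) in the
closer `UnitaryGroupTruncatedKernelIntegrableOfSiegel`:

* §1 `norm_archHom_le_of_forall`, `norm_archHom_conjAdele_le_of_forall` — archimedean sup norms on `E ⊗ ℝ` from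
  componentwise bounds (the conjugation `c ⊗ 1` permutes the infinite places isometrically, ★
  `InfiniteAdeleRing.norm_smul_apply_smul`); `continuous_rootValue₁₂`, `rootValue₁₂_mul`;
  **`exists_rootNorms_le_rpow_of_balance`** — on `S = Ω · S_T · (B ∩ K_U)` above height `1`,
  `max (‖(d₀⁻¹d₁)_∞‖, ‖(d₀⁻¹d₂)_∞‖, ‖(d₁⁻¹d₂)_∞‖) ≤ κ' · H(b)^{-1/[E:ℚ]}` from the BALANCE clause of ★
  `exists_torusSiegelSet` for `(0,1)`, `d₁⁻¹d₂ = c(d₀⁻¹d₁)` and `d₀⁻¹d₂ = (d₀⁻¹d₁)(d₁⁻¹d₂)` (★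
  `conjAdele_rootOne_eq`), `H ≥ 1` absorbing the square, and compactness of `B ∩ K_U` for the `K_T`-factor of
  `torusPart b`.
* §2 **`forall_diagUnit_of_export`** — the torus factor `S_T · K_T` of the thin set lies in «compact · ray» in the
  letters of ★ `setLIntegral_rpow_neg_borelHeight_lt_top_of_diagUnit` (row H10b), from the polar EXPORT.

## References
* J. D. Rogawski, *Automorphic Representations of Unitary Groups in Three Variables*, Ann. of Math. Stud.
  123 (1990), §2.2 (p. 13) [Rogawski1990].
* A. Borel, *Introduction aux groupes arithmétiques* (1969), §12–§13 [Borel1969].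
* J. Arthur, *A trace formula for reductive groups I*, Duke Math. J. 45 (1978), §8 (pp. 947–950)
  [Arthur1978TraceFormulaI].
-/

set_option autoImplicit false

noncomputable section

open NumberField NumberField.mixedEmbedding IsDedekindDomain Set Topology
open scoped NNReal Pointwise MatrixGroups Classical

namespace Literature.NumberTheory.Automorphic

namespace UnitaryGroup

variable {F E : Type} [Field F] [NumberField F] [Field E] [NumberField E] [Algebra F E]
  {c : E ≃ₐ[F] E}

/-! ## §1 GLUE (ρ): the root norms on the Siegel set are `≲ H^{-1/[E:ℚ]}` -/

omit [NumberField F] in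
/-- `‖ι(y)‖ ≤ R` once all `‖y_w‖ ≤ R` (`ι = ringEquiv_mixedSpace` is componentwise isometric; as in
`TorusIntegrandGL2PhiBound`). [folklore] -/
private theorem norm_ringEquiv_mixedSpace_le₁₁ (y : InfiniteAdeleRing E) {R : ℝ} (hR : 0 ≤ R)
    (h : ∀ w, ‖y w‖ ≤ R) : ‖InfiniteAdeleRing.ringEquiv_mixedSpace E y‖ ≤ R := by
  refine max_le ?_ ?_
  · refine (pi_norm_le_iff_of_nonneg hR).2 fun w => ?_
    have h1 : ‖y w.1‖ = ‖(InfiniteAdeleRing.ringEquiv_mixedSpace E y).1 w‖ := by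
      rw [InfiniteAdeleRing.ringEquiv_mixedSpace_apply]
      exact ((AddMonoidHomClass.isometry_iff_norm _).1
        (NumberField.InfinitePlace.Completion.isometry_extensionEmbeddingOfIsReal w.2) _).symm
    rw [← h1]; exact h w.1
  · refine (pi_norm_le_iff_of_nonneg hR).2 fun w => ?_
    have h1 : ‖y w.1‖ = ‖(InfiniteAdeleRing.ringEquiv_mixedSpace E y).2 w‖ := by
      rw [InfiniteAdeleRing.ringEquiv_mixedSpace_apply]
      exact ((AddMonoidHomClass.isometry_iff_norm _).1
        (NumberField.InfinitePlace.Completion.isometry_extensionEmbedding w.1) _).symm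
    rw [← h1]; exact h w.1

omit [NumberField F] in
/-- `‖x_∞‖ ≤ R` once `‖x_w‖ ≤ R` for every `w ∣ ∞` (`archHom = ringEquiv_mixedSpace ∘ fst`, componentwise
isometric: the sup norm on `E ⊗ ℝ = ∏_{w ∣ ∞} E_w`). [cite: CasselsFrohlichANT1967, Ch. II §12] -/
theorem norm_archHom_le_of_forall {x : AdeleRing (𝓞 E) E} {R : ℝ} (hR : 0 ≤ R)
    (h : ∀ w : InfinitePlace E, ‖x.1 w‖ ≤ R) : ‖archHom E x‖ ≤ R := by
  rw [archHom_apply]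
  exact norm_ringEquiv_mixedSpace_le₁₁ _ hR h

omit [NumberField F] in
/-- `‖(c x)_∞‖ ≤ R` once `‖x_w‖ ≤ R` for every `w ∣ ∞`: `c ⊗ 1` permutes the infinite places isometrically
(★ `InfiniteAdeleRing.norm_smul_apply_smul`). [cite: CasselsFrohlichANT1967, Ch. VII §1.1] -/
theorem norm_archHom_conjAdele_le_of_forall {x : AdeleRing (𝓞 E) E} {R : ℝ} (hR : 0 ≤ R)
    (h : ∀ w : InfinitePlace E, ‖x.1 w‖ ≤ R) : ‖archHom E (conjAdele F E c x)‖ ≤ R := by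
  refine norm_archHom_le_of_forall hR fun w => ?_
  rw [conjAdele_apply, AdeleRing.smul_fst]
  have e := InfiniteAdeleRing.norm_smul_apply_smul F c x.1 (c⁻¹ • w)
  rw [smul_inv_smul] at e
  rw [e]
  exact h _

omit [NumberField F] in
/-- `archHom` is continuous. [folklore] -/
private theorem continuous_archHom₁₁ : Continuous (archHom E) :=
  (continuous_ringEquiv_mixedSpace E).comp continuous_fst

/-- The root value `b ↦ d₁⁻¹ d₂` (`d = diagUnit b`) is continuous on `B(𝔸_F)`. [cite: Rogawski1990, §1.10] -/
theorem continuous_rootValue₁₂ : Continuous fun b : borelAdelic F E c 3 =>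
    (((diagUnit b.2 1)⁻¹ * diagUnit b.2 2 : (AdeleRing (𝓞 E) E)ˣ) : AdeleRing (𝓞 E) E) :=
  Units.continuous_val.comp
    (((continuous_apply 1).comp continuous_diagUnit).inv.mul ((continuous_apply 2).comp continuous_diagUnit))

/-- Root value `d₁⁻¹ d₂` of a product of torus elements. [cite: Rogawski1990, §1.10] -/
theorem rootValue₁₂_mul {t t' : borelAdelic F E c 3} (ht : torusPart t = t) (ht' : torusPart t' = t') :
    (((diagUnit (t * t').2 1)⁻¹ * diagUnit (t * t').2 2 : (AdeleRing (𝓞 E) E)ˣ) : AdeleRing (𝓞 E) E) =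
      (((diagUnit t.2 1)⁻¹ * diagUnit t.2 2 : (AdeleRing (𝓞 E) E)ˣ) : AdeleRing (𝓞 E) E) *
        (((diagUnit t'.2 1)⁻¹ * diagUnit t'.2 2 : (AdeleRing (𝓞 E) E)ˣ) : AdeleRing (𝓞 E) E) := by
  rw [← Units.val_mul, diagUnit_mul_of_torusPart_eq ht ht' 1, diagUnit_mul_of_torusPart_eq ht ht' 2]
  congr 1
  rw [mul_inv]
  simp only [mul_assoc, mul_left_comm]

/-- **GLUE (ρ) — THE ROOT NORMS ON THE SIEGEL SET DECAY LIKE `H^{-1/[E:ℚ]}`.**  Let `S_T ⊆ T(𝔸_F)` satisfy the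
BALANCE clause of ★ `exists_torusSiegelSet` (`‖(d₀⁻¹d₁)_w‖ ≤ κ · H(t)^{-1/[E:ℚ]}` for `t ∈ S_T`, `w ∣ ∞`) and let
`Ω ⊆ N(𝔸_F)`.  Then there is `κ' ≥ 0` with, for every `b ∈ Ω · S_T · (B ∩ K_U)` of height `H(b) ≥ 1` and
`d = diagUnit b`:
`max (max ‖(d₀⁻¹d₁)_∞‖ ‖(d₀⁻¹d₂)_∞‖) ‖(d₁⁻¹d₂)_∞‖ ≤ κ' · H(b)^{-1/[E:ℚ]}` (sup norms on `E ⊗ ℝ`).  With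
`b = n t k`: `d(b) = d(t) · d(torusPart k)` (the second factor over the compact `B ∩ K_U`), `H(b) = H(t)`,
`d₁⁻¹d₂ = c(d₀⁻¹d₁)` and `d₀⁻¹d₂ = (d₀⁻¹d₁)(d₁⁻¹d₂)` (★ `conjAdele_rootOne_eq`), `H ≥ 1` absorbing the second
power. This is the scale `ρ(d)` of the three-factor normal form (row H5b) read on the Siegel set.
[cite: Rogawski1990, §2.2 (p. 13)] [cite: Borel1969, §12.3] -/
theorem exists_rootNorms_le_rpow_of_balance {Ω ST : Set (borelAdelic F E c 3)}
    (hΩN : Ω ⊆ (unipotentInBorel F E c 3 : Set (borelAdelic F E c 3)))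
    (hSTt : ∀ t ∈ ST, torusPart t = t) {κ : ℝ}
    (hbal : ∀ t ∈ ST, ∀ w : InfinitePlace E,
      ‖((((diagUnit t.2 0)⁻¹ * diagUnit t.2 1 : (AdeleRing (𝓞 E) E)ˣ) : AdeleRing (𝓞 E) E)).1 w‖ ≤
        κ * ((borelHeight (t : (quasiSplit F E c 3).Adelic) : ℝ) ^ (-(1 / (Module.finrank ℚ E : ℝ))))) :
    ∃ κ' : ℝ, 0 ≤ κ' ∧ ∀ b ∈ Ω * ST * {k : borelAdelic F E c 3 |
        adelicVal F E c 3 ((StdForm.antidiagonal 3).over E) (k : (quasiSplit F E c 3).Adelic) ∈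
          standardMaximalCompactGL 3 E},
      1 ≤ borelHeight (b : (quasiSplit F E c 3).Adelic) →
      max (max ‖archHom E ((((diagUnit b.2 0)⁻¹ * diagUnit b.2 1 : (AdeleRing (𝓞 E) E)ˣ)) : AdeleRing (𝓞 E) E)‖
          ‖archHom E ((((diagUnit b.2 0)⁻¹ * diagUnit b.2 2 : (AdeleRing (𝓞 E) E)ˣ)) : AdeleRing (𝓞 E) E)‖)
          ‖archHom E ((((diagUnit b.2 1)⁻¹ * diagUnit b.2 2 : (AdeleRing (𝓞 E) E)ˣ)) : AdeleRing (𝓞 E) E)‖ ≤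
        κ' * ((borelHeight (b : (quasiSplit F E c 3).Adelic) : ℝ) ^ (-(1 / (Module.finrank ℚ E : ℝ)))) := by
  -- `B ∩ K_U` is compact; bounds for the root norms of `torusPart k`, `k ∈ B ∩ K_U`
  set KB : Set (borelAdelic F E c 3) := {k : borelAdelic F E c 3 |
    adelicVal F E c 3 ((StdForm.antidiagonal 3).over E) (k : (quasiSplit F E c 3).Adelic) ∈
      standardMaximalCompactGL 3 E} with hKB
  have hKBc : IsCompact KB := isCompact_setOf_adelicVal_mem
  obtain ⟨K₁, hK₁⟩ := hKBc.exists_bound_of_continuousOn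
    ((continuous_archHom₁₁ (E := E)).comp (continuous_rootValue₁ (F := F) (E := E) (c := c))).continuousOn
  obtain ⟨K₂, hK₂⟩ := hKBc.exists_bound_of_continuousOn
    ((continuous_archHom₁₁ (E := E)).comp (continuous_rootValue₂ (F := F) (E := E) (c := c))).continuousOn
  obtain ⟨K₃, hK₃⟩ := hKBc.exists_bound_of_continuousOn
    ((continuous_archHom₁₁ (E := E)).comp (continuous_rootValue₁₂ (F := F) (E := E) (c := c))).continuousOn
  set κ₀ : ℝ := max κ 0 with hκ₀
  have hκ₀0 : 0 ≤ κ₀ := le_max_right _ _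
  set L₁ : ℝ := max K₁ 0 with hL₁
  set L₂ : ℝ := max K₂ 0 with hL₂
  set L₃ : ℝ := max K₃ 0 with hL₃
  refine ⟨max (κ₀ * L₁) (max (κ₀ * κ₀ * L₂) (κ₀ * L₃)), le_max_of_le_left (mul_nonneg hκ₀0 (le_max_right _ _)), ?_⟩
  rintro b ⟨x, ⟨n, hn, t, ht, rfl⟩, k, hk, rfl⟩ hH
  -- letters
  set n' : ℝ := (Module.finrank ℚ E : ℝ) with hn'
  have hnN : ((n : borelAdelic F E c 3) : (quasiSplit F E c 3).Adelic) ∈ adelicUnipotent F E c 3 := hΩN hn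
  have htt : torusPart t = t := hSTt t ht
  set tk : borelAdelic F E c 3 := torusPart k with htk
  have htkt : torusPart tk = tk := torusPart_eq_self_of_mem (torusPart_mem_torusAdelic k)
  have hTP : torusPart (n * t * k) = t * tk := torusPart_mul_mul_eq hnN htt
  have hHt : borelHeight (((n * t * k : borelAdelic F E c 3)) : (quasiSplit F E c 3).Adelic) =
      borelHeight ((t : borelAdelic F E c 3) : (quasiSplit F E c 3).Adelic) := borelHeight_mul_mul_eq hnN hk
  rw [hHt] at hH ⊢
  set h : ℝ := ((borelHeight ((t : borelAdelic F E c 3) : (quasiSplit F E c 3).Adelic) : ℝ) ^ (-(1 / n')))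
    with hh
  have hHpos : (0 : ℝ) < (borelHeight ((t : borelAdelic F E c 3) : (quasiSplit F E c 3).Adelic) : ℝ) :=
    NNReal.coe_pos.2 (borelHeight_pos _)
  have hh0 : 0 < h := Real.rpow_pos_of_pos hHpos _
  have hh1 : h ≤ 1 :=
    Real.rpow_le_one_of_one_le_of_nonpos (by exact_mod_cast hH)
      (neg_nonpos.2 (div_nonneg zero_le_one (Nat.cast_nonneg _)))
  -- the diagonal of `b` is that of `t · tk`
  have hroot : ∀ i, diagUnit (n * t * k).2 i = diagUnit (t * tk).2 i := fun i => by
    rw [← diagUnit_torusPart (n * t * k) i, hTP]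
  have e₁ : ((((diagUnit (n * t * k).2 0)⁻¹ * diagUnit (n * t * k).2 1 : (AdeleRing (𝓞 E) E)ˣ)) : AdeleRing (𝓞 E) E) =
      (((diagUnit t.2 0)⁻¹ * diagUnit t.2 1 : (AdeleRing (𝓞 E) E)ˣ) : AdeleRing (𝓞 E) E) *
        (((diagUnit tk.2 0)⁻¹ * diagUnit tk.2 1 : (AdeleRing (𝓞 E) E)ˣ) : AdeleRing (𝓞 E) E) := by
    rw [hroot 0, hroot 1]; exact rootValue₁_mul htt htkt
  have e₂ : ((((diagUnit (n * t * k).2 0)⁻¹ * diagUnit (n * t * k).2 2 : (AdeleRing (𝓞 E) E)ˣ)) : AdeleRing (𝓞 E) E) =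
      (((diagUnit t.2 0)⁻¹ * diagUnit t.2 2 : (AdeleRing (𝓞 E) E)ˣ) : AdeleRing (𝓞 E) E) *
        (((diagUnit tk.2 0)⁻¹ * diagUnit tk.2 2 : (AdeleRing (𝓞 E) E)ˣ) : AdeleRing (𝓞 E) E) := by
    rw [hroot 0, hroot 2]; exact rootValue₂_mul htt htkt
  have e₃ : ((((diagUnit (n * t * k).2 1)⁻¹ * diagUnit (n * t * k).2 2 : (AdeleRing (𝓞 E) E)ˣ)) : AdeleRing (𝓞 E) E) =
      (((diagUnit t.2 1)⁻¹ * diagUnit t.2 2 : (AdeleRing (𝓞 E) E)ˣ) : AdeleRing (𝓞 E) E) *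
        (((diagUnit tk.2 1)⁻¹ * diagUnit tk.2 2 : (AdeleRing (𝓞 E) E)ˣ) : AdeleRing (𝓞 E) E) := by
    rw [hroot 1, hroot 2]; exact rootValue₁₂_mul htt htkt
  -- the `tk`-factors are bounded (`diagUnit tk = diagUnit k`, `k ∈ B ∩ K_U`)
  have htkd : ∀ i, diagUnit tk.2 i = diagUnit k.2 i := fun i => diagUnit_torusPart k i
  have b₁ : ‖archHom E ((((diagUnit tk.2 0)⁻¹ * diagUnit tk.2 1 : (AdeleRing (𝓞 E) E)ˣ)) : AdeleRing (𝓞 E) E)‖ ≤ L₁ := by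
    rw [htkd 0, htkd 1]; exact (hK₁ k hk).trans (le_max_left _ _)
  have b₂ : ‖archHom E ((((diagUnit tk.2 0)⁻¹ * diagUnit tk.2 2 : (AdeleRing (𝓞 E) E)ˣ)) : AdeleRing (𝓞 E) E)‖ ≤ L₂ := by
    rw [htkd 0, htkd 2]; exact (hK₂ k hk).trans (le_max_left _ _)
  have b₃ : ‖archHom E ((((diagUnit tk.2 1)⁻¹ * diagUnit tk.2 2 : (AdeleRing (𝓞 E) E)ˣ)) : AdeleRing (𝓞 E) E)‖ ≤ L₃ := by
    rw [htkd 1, htkd 2]; exact (hK₃ k hk).trans (le_max_left _ _)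
  -- the `t`-factors: BALANCE, its `c`-conjugate, and their product
  have hbal' : ∀ w : InfinitePlace E,
      ‖((((diagUnit t.2 0)⁻¹ * diagUnit t.2 1 : (AdeleRing (𝓞 E) E)ˣ) : AdeleRing (𝓞 E) E)).1 w‖ ≤ κ₀ * h :=
    fun w => (hbal t ht w).trans (mul_le_mul_of_nonneg_right (le_max_left _ _) hh0.le)
  have a₁ : ‖archHom E ((((diagUnit t.2 0)⁻¹ * diagUnit t.2 1 : (AdeleRing (𝓞 E) E)ˣ)) : AdeleRing (𝓞 E) E)‖ ≤ κ₀ * h :=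
    norm_archHom_le_of_forall (mul_nonneg hκ₀0 hh0.le) hbal'
  have a₃ : ‖archHom E ((((diagUnit t.2 1)⁻¹ * diagUnit t.2 2 : (AdeleRing (𝓞 E) E)ˣ)) : AdeleRing (𝓞 E) E)‖ ≤ κ₀ * h := by
    rw [← (conjAdele_rootOne_eq t).1]
    exact norm_archHom_conjAdele_le_of_forall (mul_nonneg hκ₀0 hh0.le) hbal'
  have a₂ : ‖archHom E ((((diagUnit t.2 0)⁻¹ * diagUnit t.2 2 : (AdeleRing (𝓞 E) E)ˣ)) : AdeleRing (𝓞 E) E)‖ ≤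
      κ₀ * κ₀ * h := by
    rw [← (conjAdele_rootOne_eq t).2, map_mul]
    refine (norm_mul_le _ _).trans ?_
    calc ‖archHom E ((((diagUnit t.2 0)⁻¹ * diagUnit t.2 1 : (AdeleRing (𝓞 E) E)ˣ)) : AdeleRing (𝓞 E) E)‖ *
          ‖archHom E ((((diagUnit t.2 1)⁻¹ * diagUnit t.2 2 : (AdeleRing (𝓞 E) E)ˣ)) : AdeleRing (𝓞 E) E)‖
        ≤ (κ₀ * h) * (κ₀ * h) := mul_le_mul a₁ a₃ (norm_nonneg _) (mul_nonneg hκ₀0 hh0.le)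
      _ = κ₀ * κ₀ * h * h := by ring
      _ ≤ κ₀ * κ₀ * h * 1 := mul_le_mul_of_nonneg_left hh1 (mul_nonneg (mul_nonneg hκ₀0 hκ₀0) hh0.le)
      _ = κ₀ * κ₀ * h := mul_one _
  -- assemble
  have hmax : κ₀ * L₁ * h ≤ max (κ₀ * L₁) (max (κ₀ * κ₀ * L₂) (κ₀ * L₃)) * h ∧
      κ₀ * κ₀ * L₂ * h ≤ max (κ₀ * L₁) (max (κ₀ * κ₀ * L₂) (κ₀ * L₃)) * h ∧
      κ₀ * L₃ * h ≤ max (κ₀ * L₁) (max (κ₀ * κ₀ * L₂) (κ₀ * L₃)) * h :=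
    ⟨mul_le_mul_of_nonneg_right (le_max_left _ _) hh0.le,
      mul_le_mul_of_nonneg_right ((le_max_left _ _).trans (le_max_right _ _)) hh0.le,
      mul_le_mul_of_nonneg_right ((le_max_right _ _).trans (le_max_right _ _)) hh0.le⟩
  refine max_le (max_le ?_ ?_) ?_
  · rw [e₁, map_mul]
    refine (norm_mul_le _ _).trans ?_
    calc _ ≤ (κ₀ * h) * L₁ := mul_le_mul a₁ b₁ (norm_nonneg _) (mul_nonneg hκ₀0 hh0.le)
      _ = κ₀ * L₁ * h := by ring
      _ ≤ _ := hmax.1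
  · rw [e₂, map_mul]
    refine (norm_mul_le _ _).trans ?_
    calc _ ≤ (κ₀ * κ₀ * h) * L₂ := mul_le_mul a₂ b₂ (norm_nonneg _) (mul_nonneg (mul_nonneg hκ₀0 hκ₀0) hh0.le)
      _ = κ₀ * κ₀ * L₂ * h := by ring
      _ ≤ _ := hmax.2.1
  · rw [e₃, map_mul]
    refine (norm_mul_le _ _).trans ?_
    calc _ ≤ (κ₀ * h) * L₃ := mul_le_mul a₃ b₃ (norm_nonneg _) (mul_nonneg hκ₀0 hh0.le)
      _ = κ₀ * L₃ * h := by ring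
      _ ≤ _ := hmax.2.2

/-! ## §2 The torus factor `S_T · K_T` of the thin set lies in «compact · ray» -/

/-- **`S_T · K_T ⊆ {t | d₀(t) ∈ (W · d₀(K_B)) · ray, d₁(t) ∈ W · d₁(K_B)}`** — the hypothesis `hS` of ★
`setLIntegral_rpow_neg_borelHeight_lt_top_of_diagUnit` for the torus factor of the thin set, from the polar
EXPORT of ★ `exists_torusSiegelSet` (`d₀(t) = w · z(eˢ)`, `d₁(t) ∈ W`) and multiplicativity of the diagonal on
torus elements (★ `diagUnit_mul_of_torusPart_eq`); both windows are compact (`B ∩ K_U` is compact, ★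
`isCompact_setOf_adelicVal_mem`). [cite: Borel1969, §12.3] [cite: Rogawski1990, §2.2 (p. 13)] -/
theorem forall_diagUnit_of_export {ST : Set (borelAdelic F E c 3)} {W : Set (AdeleRing (𝓞 E) E)ˣ}
    (hW : IsCompact W) (hSTt : ∀ t ∈ ST, torusPart t = t)
    (hexp : ∀ t ∈ ST, ∃ w ∈ W, ∃ s : ℝ,
      diagUnit t.2 0 = w * posRealIdele E (expUnitNNReal s) ∧ diagUnit t.2 1 ∈ W) :
    IsCompact (W * ((fun k : borelAdelic F E c 3 => diagUnit k.2 0) '' {k : borelAdelic F E c 3 |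
        adelicVal F E c 3 ((StdForm.antidiagonal 3).over E) (k : (quasiSplit F E c 3).Adelic) ∈
          standardMaximalCompactGL 3 E})) ∧
    IsCompact (W * ((fun k : borelAdelic F E c 3 => diagUnit k.2 1) '' {k : borelAdelic F E c 3 |
        adelicVal F E c 3 ((StdForm.antidiagonal 3).over E) (k : (quasiSplit F E c 3).Adelic) ∈
          standardMaximalCompactGL 3 E})) ∧
    ∀ t : torusInBorel F E c 3, (t : borelAdelic F E c 3) ∈ ST * {k : borelAdelic F E c 3 |
        adelicVal F E c 3 ((StdForm.antidiagonal 3).over E) (k : (quasiSplit F E c 3).Adelic) ∈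
          standardMaximalCompactGL 3 E ∧ torusPart k = k} →
      (∃ w ∈ W * ((fun k : borelAdelic F E c 3 => diagUnit k.2 0) '' {k : borelAdelic F E c 3 |
          adelicVal F E c 3 ((StdForm.antidiagonal 3).over E) (k : (quasiSplit F E c 3).Adelic) ∈
            standardMaximalCompactGL 3 E}),
        ∃ s : ℝ, diagUnit (t : borelAdelic F E c 3).2 0 = w * posRealIdele E (expUnitNNReal s)) ∧
      diagUnit (t : borelAdelic F E c 3).2 1 ∈ W * ((fun k : borelAdelic F E c 3 => diagUnit k.2 1) ''
        {k : borelAdelic F E c 3 |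
          adelicVal F E c 3 ((StdForm.antidiagonal 3).over E) (k : (quasiSplit F E c 3).Adelic) ∈
            standardMaximalCompactGL 3 E}) := by
  have hKBc : IsCompact {k : borelAdelic F E c 3 |
      adelicVal F E c 3 ((StdForm.antidiagonal 3).over E) (k : (quasiSplit F E c 3).Adelic) ∈
        standardMaximalCompactGL 3 E} := isCompact_setOf_adelicVal_mem
  refine ⟨hW.mul (hKBc.image ((continuous_apply 0).comp continuous_diagUnit)),
    hW.mul (hKBc.image ((continuous_apply 1).comp continuous_diagUnit)), ?_⟩
  rintro t ⟨t₀, ht₀, k, ⟨hk, hkt⟩, e⟩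
  obtain ⟨w, hw, s, h0, h1⟩ := hexp t₀ ht₀
  have ht₀t : torusPart t₀ = t₀ := hSTt t₀ ht₀
  have e0 : diagUnit (t : borelAdelic F E c 3).2 0 = diagUnit t₀.2 0 * diagUnit k.2 0 := by
    rw [← e]; exact diagUnit_mul_of_torusPart_eq ht₀t hkt 0
  have e1 : diagUnit (t : borelAdelic F E c 3).2 1 = diagUnit t₀.2 1 * diagUnit k.2 1 := by
    rw [← e]; exact diagUnit_mul_of_torusPart_eq ht₀t hkt 1
  refine ⟨⟨w * diagUnit k.2 0, Set.mul_mem_mul hw ⟨k, hk, rfl⟩, s, ?_⟩, ?_⟩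
  · rw [e0, h0, mul_right_comm]
  · rw [e1]; exact Set.mul_mem_mul h1 ⟨k, hk, rfl⟩

end UnitaryGroup

end Literature.NumberTheory.Automorphic
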